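import Summits.BirchSwinnertonDyer.BirchSwinnertonDyer.Theorems.TeichmullerTwistDescentLocalPTorsionCyclic
import Literature.NumberTheory.EllipticCurves.GoodReductionInertia
import Summits.BirchSwinnertonDyer.Rank1Residual.Additive.AdditiveKernelMultiplicationByP
import HarnessLib

/-!
# The rational `p`-torsion LINE of an elliptic curve over a field without `ζ_p` (`ℚ_p`, `ℚ`, …), and its place in
# the reduction of the minimal model at an ADDITIVE prime (integral coordinates) — LINE-7 typable layer of crux LOW

Cell `pub/bsd-wall`, D-0145 line `route-BirchSwinnertonDyer-TeichmullerTwistDescent` (rev 5), crux LOW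
`SupersingularTorsionOptimalManinUnitFive` (stmt-BirchSwinnertonDyer-23884: `W/ℚ` minimal, Kodaira II at `5`,
`E[5]` irreducible, potentially supersingular, a `ℚ₅`-rational point `P` of order `5`, `D` lattice-optimal ⟹
`5 ∤ c(D)`), seat `bsd-line-ttd-p1` g3. THEOREMS ONLY (no definition, no named fact, no `sorry`); a `--supports`
helper: BSD is not proved here and LOW stays open. Companion of the sibling seat's
`TeichmullerTwistDescentLocalPTorsionCyclic` (ns `…TeichmullerTwistDescent.LocalPTorsion`: `E(ℚ_p)[p]` of a curve
OVER `ℚ` is cyclic for odd `p` — the planner's LINE-7 stub `stub_fiveTorsion_semisimplification` verbatim), which this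
file imports and does not restate. It adds (a) the same cyclicity for every elliptic curve over ANY field of
characteristic `0` without a primitive `p`-th root of unity, as an `IsAddCyclic` API (any `V/ℚ_p`; `E(ℚ)[p]`), and
(b) WHERE that line sits in the reduction of the minimal model at an additive prime: torsion points have integral
coordinates ("`P` is NOT in the formal group", the second clause of the planner's Step 1 in `idea-low-torsion-pinned-kerf`).

## What is proved

* §1 (any field `F` of characteristic `0`, any elliptic `V/F`, any prime `p`): `E(F)[p]` is finite of order
  `p^k`, `k ≤ 2` (`natCard_torsionBy_prime_eq_pow`: `E(F) ↪ E(F̄)`, `#E(F̄)[p] = p²` — tree `card_torsionBy_eq_sq`,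
  Silverman *AEC* III.6.4(b) — and Cauchy); if `F` has NO primitive `p`-th root of unity then `#E(F)[p] ∣ p`
  (`natCard_torsionBy_prime_dvd_of_forall_not_isPrimitiveRoot`: the case `p²` is excluded by the tree's PROVED
  Weil-pairing corollary `WeierstrassCurve.exists_isPrimitiveRoot_of_card_torsionBy_eq_sq_holds`, *AEC* III.8.1.1),
  so **`E(F)[p]` is cyclic** (`isAddCyclic_torsionBy_prime_of_forall_not_isPrimitiveRoot`) with a generator in the
  `ℕ`-multiple form the crux binders use (`exists_generator_of_forall_not_isPrimitiveRoot`).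
* §2 (`F = ℚ_p`, `p` odd; `ζ_p ∉ ℚ_p` is the sibling's `not_isPrimitiveRoot_padic_self`): for EVERY elliptic curve
  `V/ℚ_p` — `isAddCyclic_torsionBy_prime_padic`, `natCard_torsionBy_prime_padic_dvd`, `exists_generator_padic`.
* §3 (`F = ℚ`, `p` odd): `not_isPrimitiveRoot_rat_of_odd`, **`E(ℚ)[p]` cyclic** (`isAddCyclic_torsionBy_prime_rat`),
  `#E(ℚ)[p] ∣ p`.
* §4 (`W/ℚ` globally minimal, `Addv W p`): every torsion point of `E(F)` — `F ⊇ ℚ` any valued field with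
  `p ≠ 0`, `|p| < 1`, however ramified — has INTEGRAL coordinates on the minimal model
  (`val_le_one_of_zsmul_eq_zero_of_addv`; over `ℚ_p`: `norm_le_one_of_zsmul_eq_zero_of_addv`,
  `norm_le_one_of_prime_nsmul_eq_zero_of_addv`): it is not in the kernel of reduction `E₁(F)`, which is
  torsion-free at an additive prime by the tree's LEMMA A (`Additive.zsmul_ne_zero_of_addv_of_one_lt_val`: the formal
  group is `Ĝ_a`), read on `W ⊗ F` through the bridge `map_integralModelInt_eq_baseChange`; `|y| ≤ 1` then follows
  from the integral equation (tree `val_y_le_one`).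
* §5 `low_torsion_line`: on the binders of LOW (indeed at every additive odd `p` with a `ℚ_p`-rational point of
  order `p`) the three facts together: `#E(ℚ_p)[p] = p` and one non-zero generator (sibling's theorems), integral
  coordinates (§4).

What is NOT here (untypable today, recorded in the idea card): the finite-flat layer of LINE 7 (closure of
`ℤ/5·P` in `Ẽ_U[5]` is the Tate–Oort scheme `G_{4,2}`, upward rigidity at `e = 6`, socle injectivity into the
Néron model of `J₀(N)`), which awaits `defn-NeronKernelData`; and the Galois shadow `E[p]|G_{ℚ_p} ≅ (1 *; 0 ω)`.

References: J. H. Silverman, *The Arithmetic of Elliptic Curves*, GTM 106 (2009), Cor. III.6.4(b), Cor. III.8.1.1,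
VII.3.1, Exercise 3.7(d) [SilvermanAEC2009]; J.-P. Serre, *A Course in Arithmetic* (1973), Ch. II §3.1 Prop. 7
(roots of unity of `ℚ_p`) [Serre1973]; M. Kosters, R. Pannekoek, arXiv:1703.07888, Thm. 1 / Cor. 2 (the
exceptional additive curves with `E(ℚ_p)[p] ≠ 0`, context for LOW) [KostersPannekoek2017]; B. Mazur, Publ. Math.
IHÉS 47 (1977) Ch. III §5 Step 1 (context) [Mazur1977]. Design: no definitions; `Type u` for the general field (the
tree's `card_torsionBy_eq_sq` is universe-monomorphic in the algebraic closure); axioms `propext`,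
`Classical.choice`, `Quot.sound`.
-/

-- the Theorems directory repeats the summit name (sibling precedent `EdixhovenFibreFiveSevenKPResidueOfCornerLow.lean`)
set_option linter.dupNamespace false

noncomputable section

open scoped Classical NNReal

namespace Summit.BirchSwinnertonDyer.BirchSwinnertonDyer.Theorems.TeichmullerTwistDescent.LocalPTorsionLine

open WeierstrassCurve

universe u

/-! ## §1 Any field of characteristic `0`: `#E(F)[p] = p^k`, `k ≤ 2`; `k ≤ 1` without `ζ_p`; cyclicity -/

section General

variable {F : Type u} [Field F] [DecidableEq F] [CharZero F] (V : WeierstrassCurve F) [V.IsElliptic] (p : ℕ)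
  [hp : Fact p.Prime]

/-- **`E(F)[p]` is finite with at most `p²` elements** for an elliptic curve over a field `F` of characteristic
`0` and a prime `p`: `E(F) ↪ E(F̄)` (`Affine.Point.map_injective`) and `#E(F̄)[p] = p²` (tree `card_torsionBy_eq_sq`).
[cite: SilvermanAEC2009, Cor. III.6.4(b)] -/
theorem finite_torsionBy_prime_and_natCard_le :
    Finite (AddSubgroup.torsionBy V.toAffine.Point (p : ℤ)) ∧
      Nat.card (AddSubgroup.torsionBy V.toAffine.Point (p : ℤ)) ≤ p ^ 2 := by
  set L := AlgebraicClosure F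
  let ι : V.toAffine.Point →+ (V.baseChange L).toAffine.Point :=
    Affine.Point.baseChange (W' := V) F L
  have hι : Function.Injective ι := Affine.Point.map_injective (W' := V) _
  haveI : (V.baseChange L).IsElliptic := inferInstanceAs (V.map (algebraMap F L)).IsElliptic
  have hnL : ((p : ℕ) : L) ≠ 0 := by exact_mod_cast hp.out.ne_zero
  have key : Nat.card (AddSubgroup.torsionBy (V.baseChange L).toAffine.Point (p : ℤ)) = p ^ 2 :=
    card_torsionBy_eq_sq (E := V.baseChange L) hnL
  have hmem : ∀ P : AddSubgroup.torsionBy V.toAffine.Point (p : ℤ),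
      ι P ∈ AddSubgroup.torsionBy (V.baseChange L).toAffine.Point (p : ℤ) := fun P => by
    have hP : p • (P : V.toAffine.Point) = 0 := AddSubgroup.torsionBy.nsmul_iff.mp P.2
    rw [AddSubgroup.torsionBy.nsmul_iff, ← map_nsmul, hP, map_zero]
  let ι' : AddSubgroup.torsionBy V.toAffine.Point (p : ℤ) →
      AddSubgroup.torsionBy (V.baseChange L).toAffine.Point (p : ℤ) := fun P => ⟨ι P, hmem P⟩
  have hι' : Function.Injective ι' := fun P Q hPQ =>
    Subtype.ext (hι (congrArg Subtype.val hPQ))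
  haveI : Finite (AddSubgroup.torsionBy (V.baseChange L).toAffine.Point (p : ℤ)) :=
    Nat.finite_of_card_ne_zero (by rw [key]; exact pow_ne_zero 2 hp.out.ne_zero)
  exact ⟨Finite.of_injective ι' hι', key ▸ Nat.card_le_card_of_injective ι' hι'⟩

/-- **`#E(F)[p] = p^k` with `k ≤ 2`** (characteristic `0`, `p` prime): `E(F)[p]` is killed by the prime `p`, so by
Cauchy's theorem `p` is its only prime divisor, and `#E(F)[p] ≤ p²`. [cite: SilvermanAEC2009, Cor. III.6.4(b)] -/
theorem natCard_torsionBy_prime_eq_pow :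
    ∃ k : ℕ, k ≤ 2 ∧ Nat.card (AddSubgroup.torsionBy V.toAffine.Point (p : ℤ)) = p ^ k := by
  obtain ⟨hfin, hle⟩ := finite_torsionBy_prime_and_natCard_le V p
  set G := AddSubgroup.torsionBy V.toAffine.Point (p : ℤ)
  have hprime : ∀ {d : ℕ}, d.Prime → d ∣ Nat.card G → d = p := by
    intro d hd hdvd
    haveI : Fact d.Prime := ⟨hd⟩
    obtain ⟨T, hT⟩ := exists_prime_addOrderOf_dvd_card' (G := G) d hdvd
    have hpT : p • T = 0 := by
      apply Subtype.ext
      simp only [AddSubgroup.coe_nsmul, AddSubgroup.coe_zero]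
      exact AddSubgroup.torsionBy.nsmul_iff.mp T.2
    have hd' : d ∣ p := by rw [← hT]; exact addOrderOf_dvd_of_nsmul_eq_zero hpT
    exact (Nat.prime_dvd_prime_iff_eq hd hp.out).mp hd'
  have hcard := Nat.eq_prime_pow_of_unique_prime_dvd (Nat.card_pos (α := G)).ne' hprime
  refine ⟨_, ?_, hcard⟩
  rw [hcard] at hle
  exact (Nat.pow_le_pow_iff_right hp.out.one_lt).mp hle

/-- **No `ζ_p` in `F` ⟹ `#E(F)[p] ∣ p`**: the value `#E(F)[p] = p²` would make the full `p`-torsion `F`-rational,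
and then the Weil pairing puts a primitive `p`-th root of unity in `F` (tree, PROVED:
`WeierstrassCurve.exists_isPrimitiveRoot_of_card_torsionBy_eq_sq_holds`). [cite: SilvermanAEC2009, Cor. III.8.1.1] -/
theorem natCard_torsionBy_prime_dvd_of_forall_not_isPrimitiveRoot (hμ : ∀ ζ : F, ¬ IsPrimitiveRoot ζ p) :
    Nat.card (AddSubgroup.torsionBy V.toAffine.Point (p : ℤ)) ∣ p := by
  obtain ⟨k, hk2, hk⟩ := natCard_torsionBy_prime_eq_pow V p
  have hk' : k ≠ 2 := by
    rintro rfl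
    have hpF : (p : F) ≠ 0 := by exact_mod_cast hp.out.ne_zero
    obtain ⟨ζ, hζ⟩ :=
      V.exists_isPrimitiveRoot_of_card_torsionBy_eq_sq_holds p hp.out.two_le hpF hk
    exact hμ ζ hζ
  rw [hk]
  have hk1 : k ≤ 1 := by omega
  interval_cases k
  · simp
  · simp

/-- **`E(F)[p]` is CYCLIC when `F` has no primitive `p`-th root of unity** (a group of order `1` or `p`).
[cite: SilvermanAEC2009, Cor. III.8.1.1] -/
theorem isAddCyclic_torsionBy_prime_of_forall_not_isPrimitiveRoot (hμ : ∀ ζ : F, ¬ IsPrimitiveRoot ζ p) :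
    IsAddCyclic (AddSubgroup.torsionBy V.toAffine.Point (p : ℤ)) := by
  haveI := (finite_torsionBy_prime_and_natCard_le V p).1
  have hdvd := natCard_torsionBy_prime_dvd_of_forall_not_isPrimitiveRoot V p hμ
  rcases (Nat.dvd_prime hp.out).mp hdvd with h1 | hp'
  · haveI : Subsingleton (AddSubgroup.torsionBy V.toAffine.Point (p : ℤ)) :=
      (Nat.card_eq_one_iff_unique.mp h1).1
    exact isAddCyclic_of_subsingleton
  · exact isAddCyclic_of_prime_card hp'

/-- **Generator form**: when `F` has no primitive `p`-th root of unity there is a `p`-torsion point `P ∈ E(F)`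
(possibly `O`) of which every `p`-torsion point of `E(F)` is an `ℕ`-multiple — the shape the crux binders use.
[cite: SilvermanAEC2009, Cor. III.8.1.1] -/
theorem exists_generator_of_forall_not_isPrimitiveRoot (hμ : ∀ ζ : F, ¬ IsPrimitiveRoot ζ p) :
    ∃ P : V.toAffine.Point, p • P = 0 ∧ ∀ Q : V.toAffine.Point, p • Q = 0 → ∃ k : ℕ, Q = k • P := by
  haveI := (finite_torsionBy_prime_and_natCard_le V p).1
  obtain ⟨g, hg⟩ := (isAddCyclic_torsionBy_prime_of_forall_not_isPrimitiveRoot V p hμ).exists_generator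
  refine ⟨g, AddSubgroup.torsionBy.nsmul_iff.mp g.2, fun Q hQ => ?_⟩
  have hQ' : (⟨Q, AddSubgroup.torsionBy.nsmul_iff.mpr hQ⟩ : AddSubgroup.torsionBy V.toAffine.Point (p : ℤ)) ∈
      AddSubgroup.zmultiples g := hg _
  rw [AddSubgroup.mem_zmultiples_iff] at hQ'
  obtain ⟨m, hm⟩ := hQ'
  -- reduce the integer exponent modulo `p`
  have hpg : (p : ℤ) • g = 0 := by
    rw [natCast_zsmul]; exact Subtype.ext (by
      simp only [AddSubgroup.coe_nsmul, AddSubgroup.coe_zero]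
      exact AddSubgroup.torsionBy.nsmul_iff.mp g.2)
  refine ⟨(m % (p : ℤ)).toNat, ?_⟩
  have h0 : 0 ≤ m % (p : ℤ) := Int.emod_nonneg _ (by exact_mod_cast hp.out.ne_zero)
  have e : ((m % (p : ℤ)).toNat : ℤ) • g = m • g := by
    rw [Int.toNat_of_nonneg h0]
    conv_rhs => rw [← Int.emod_add_ediv_mul m (p : ℤ)]
    rw [add_zsmul, mul_zsmul, hpg, zsmul_zero, add_zero]
  have := congrArg Subtype.val (e.trans hm)
  simpa [← natCast_zsmul] using this.symm

end General

/-! ## §2 Over `ℚ_p`, `p` odd: no `ζ_p` (sibling `LocalPTorsion.not_isPrimitiveRoot_padic_self`), so the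
`p`-torsion of EVERY elliptic curve over `ℚ_p` is a LINE -/

section Padic

variable (p : ℕ) [hp : Fact p.Prime] (V : WeierstrassCurve ℚ_[p]) [V.IsElliptic]

/-- **`E(ℚ_p)[p]` is cyclic for every elliptic curve over `ℚ_p`, `p` odd** (any `V/ℚ_p`, not only base changes
of curves over `ℚ`; `ζ_p ∉ ℚ_p` is the sibling seat's `LocalPTorsion.not_isPrimitiveRoot_padic_self`).
[cite: SilvermanAEC2009, Cor. III.8.1.1] [cite: Serre1973, Ch. II §3.1 Prop. 7] -/
theorem isAddCyclic_torsionBy_prime_padic (hp2 : p ≠ 2) :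
    IsAddCyclic (AddSubgroup.torsionBy V.toAffine.Point (p : ℤ)) :=
  isAddCyclic_torsionBy_prime_of_forall_not_isPrimitiveRoot V p
    (TeichmullerTwistDescent.LocalPTorsion.not_isPrimitiveRoot_padic_self p hp2)

/-- **`#E(ℚ_p)[p] ∈ {1, p}`** for every elliptic curve over `ℚ_p`, `p` odd.
[cite: SilvermanAEC2009, Cor. III.8.1.1] [cite: Serre1973, Ch. II §3.1 Prop. 7] -/
theorem natCard_torsionBy_prime_padic_dvd (hp2 : p ≠ 2) :
    Nat.card (AddSubgroup.torsionBy V.toAffine.Point (p : ℤ)) ∣ p :=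
  natCard_torsionBy_prime_dvd_of_forall_not_isPrimitiveRoot V p
    (TeichmullerTwistDescent.LocalPTorsion.not_isPrimitiveRoot_padic_self p hp2)

/-- **Generator of the `ℚ_p`-rational `p`-torsion** of any elliptic curve over `ℚ_p` (`p` odd): some `P` with
`p • P = O` of which every `ℚ_p`-rational `p`-torsion point is an `ℕ`-multiple (for base changes of curves over `ℚ`
with a given non-zero `P` this is the sibling's `LocalPTorsion.exists_generator_pTorsion_padic`).
[cite: SilvermanAEC2009, Cor. III.8.1.1] -/
theorem exists_generator_padic (hp2 : p ≠ 2) :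
    ∃ P : V.toAffine.Point, p • P = 0 ∧ ∀ Q : V.toAffine.Point, p • Q = 0 → ∃ k : ℕ, Q = k • P :=
  exists_generator_of_forall_not_isPrimitiveRoot V p
    (TeichmullerTwistDescent.LocalPTorsion.not_isPrimitiveRoot_padic_self p hp2)

end Padic

/-! ## §3 Over `ℚ`: `E(ℚ)[p]` is cyclic for odd `p` -/

section Rat

variable (W : WeierstrassCurve ℚ) [W.IsElliptic] (p : ℕ) [hp : Fact p.Prime]

/-- **`ζ_p ∉ ℚ` for odd `p`** (through `ℚ ↪ ℚ_p`). [cite: Serre1973, Ch. II §3.1 Prop. 7] -/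
theorem not_isPrimitiveRoot_rat_of_odd (hp2 : p ≠ 2) (ζ : ℚ) : ¬ IsPrimitiveRoot ζ p := fun hζ =>
  TeichmullerTwistDescent.LocalPTorsion.not_isPrimitiveRoot_padic_self p hp2 (ζ : ℚ_[p])
    (hζ.map_of_injective (f := Rat.castHom ℚ_[p]) (Rat.castHom ℚ_[p]).injective)

/-- **`E(ℚ)[p]` is cyclic for every elliptic curve over `ℚ` and every odd prime `p`.**
[cite: SilvermanAEC2009, Cor. III.8.1.1] -/
theorem isAddCyclic_torsionBy_prime_rat (hp2 : p ≠ 2) :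
    IsAddCyclic (AddSubgroup.torsionBy W.toAffine.Point (p : ℤ)) :=
  isAddCyclic_torsionBy_prime_of_forall_not_isPrimitiveRoot W p (not_isPrimitiveRoot_rat_of_odd p hp2)

/-- **`#E(ℚ)[p] ∣ p`** for every elliptic curve over `ℚ` and every odd prime `p`.
[cite: SilvermanAEC2009, Cor. III.8.1.1] -/
theorem natCard_torsionBy_prime_rat_dvd (hp2 : p ≠ 2) :
    Nat.card (AddSubgroup.torsionBy W.toAffine.Point (p : ℤ)) ∣ p :=
  natCard_torsionBy_prime_dvd_of_forall_not_isPrimitiveRoot W p (not_isPrimitiveRoot_rat_of_odd p hp2)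

end Rat

/-! ## §4 The minimal model at an ADDITIVE prime: torsion points have integral coordinates (are not in `E₁`) -/

section Integral

open Literature.NumberTheory.EllipticCurves Literature.NumberTheory.EllipticCurves.Rank1Residual
  Summit.BirchSwinnertonDyer.Rank1Residual

variable (W : WeierstrassCurve ℚ) [W.IsElliptic] [W.IsGloballyMinimal] (p : ℕ) [hp : Fact p.Prime]

omit [W.IsElliptic] hp in
/-- **Bridge**: over any field `F ⊇ ℚ` the base change `W ⊗ F` of a globally minimal `W/ℚ` IS the integer model
`W_ℤ = integralModelInt W` read in `F` (`ℤ → F` is the unique ring map; tree `map_integralModelInt`). [folklore] -/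
theorem map_integralModelInt_eq_baseChange (F : Type*) [Field F] [Algebra ℚ F] :
    (integralModelInt W).map (Int.castRingHom F) = W.baseChange F := by
  conv_rhs => rw [← map_integralModelInt W]
  rw [baseChange, WeierstrassCurve.map_map]
  exact congrArg (integralModelInt W).map (RingHom.ext_int _ _)

/-- **Torsion points have integral coordinates on the minimal model at an additive prime, over EVERY valued field
`F ⊇ ℚ` with `p ≠ 0` and `|p| < 1`** (however ramified, no completeness): for `P = (x, y) ∈ E(F)` with `n • P = O`,
`n ≠ 0`, one has `|x| ≤ 1` and `|y| ≤ 1` — i.e. `P ∉ E₁(F)`, the kernel of reduction being TORSION-FREE at an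
additive prime (tree LEMMA A `Additive.zsmul_ne_zero_of_addv_of_one_lt_val`: the formal group is `Ĝ_a`; then
`|y| ≤ 1` from the integral equation, tree `val_y_le_one`). [cite: SilvermanAEC2009, VII.3.1 and Exercise 3.7(d)] -/
theorem val_le_one_of_zsmul_eq_zero_of_addv {F : Type*} [Field F] [Algebra ℚ F] (w : Valuation F ℝ≥0)
    (hadd : Addv W p) (hp0 : (p : F) ≠ 0) (hp1 : w (p : F) < 1) {n : ℤ} (hn : n ≠ 0) {x y : F}
    (h : (W.baseChange F).toAffine.Nonsingular x y) (h0 : n • (Affine.Point.some x y h) = 0) :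
    w x ≤ 1 ∧ w y ≤ 1 := by
  have key : ∀ (V : WeierstrassCurve F), (integralModelInt W).map (Int.castRingHom F) = V →
      ∀ {x y : F} (h : V.toAffine.Nonsingular x y), n • (Affine.Point.some x y h) = 0 → w x ≤ 1 ∧ w y ≤ 1 := by
    rintro V rfl x y h h0
    haveI hint : ((integralModelInt W).map (Int.castRingHom F)).IsIntegral w.integer :=
      isIntegral_integer_of_val_le_one (by rw [map_a₁, eq_intCast]; exact Additive.val_intCast_le_one' w _)
        (by rw [map_a₂, eq_intCast]; exact Additive.val_intCast_le_one' w _)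
        (by rw [map_a₃, eq_intCast]; exact Additive.val_intCast_le_one' w _)
        (by rw [map_a₄, eq_intCast]; exact Additive.val_intCast_le_one' w _)
        (by rw [map_a₆, eq_intCast]; exact Additive.val_intCast_le_one' w _)
    have hx : w x ≤ 1 := by
      by_contra hx
      exact Additive.zsmul_ne_zero_of_addv_of_one_lt_val W p w hadd hp0 hp1 hn h (not_le.mp hx) h0
    exact ⟨hx, val_y_le_one h.left hx⟩
  exact key _ (map_integralModelInt_eq_baseChange W F) h h0

/-- **Over `ℚ_p`: a torsion point of `E(ℚ_p)` has `p`-adically integral coordinates on the minimal model at an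
additive prime** (`‖x‖ ≤ 1`, `‖y‖ ≤ 1`: it reduces to an affine point of the cuspidal fibre, not to `Õ`).
[cite: SilvermanAEC2009, VII.3.1 and Exercise 3.7(d)] -/
theorem norm_le_one_of_zsmul_eq_zero_of_addv (hadd : Addv W p) {n : ℤ} (hn : n ≠ 0) {x y : ℚ_[p]}
    (h : (W.baseChange ℚ_[p]).toAffine.Nonsingular x y) (h0 : n • (Affine.Point.some x y h) = 0) :
    ‖x‖ ≤ 1 ∧ ‖y‖ ≤ 1 := by
  have hp0 : (p : ℚ_[p]) ≠ 0 := by exact_mod_cast hp.out.ne_zero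
  have hp1 : NormedField.valuation (K := ℚ_[p]) (p : ℚ_[p]) < 1 := by
    rw [NormedField.valuation_apply, ← NNReal.coe_lt_coe, coe_nnnorm]
    exact Padic.norm_p_lt_one
  obtain ⟨hx, hy⟩ := val_le_one_of_zsmul_eq_zero_of_addv W p (NormedField.valuation (K := ℚ_[p])) hadd hp0 hp1 hn h h0
  rw [NormedField.valuation_apply, ← NNReal.coe_le_coe, coe_nnnorm] at hx hy
  exact ⟨hx, hy⟩

/-- **The `ℚ_p`-rational `p`-torsion at an additive prime is integral** (`ℕ`-scalar form of the previous theorem at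
`n = p`): a point `P = (x, y)` of `E(ℚ_p)` with `p • P = O` has `‖x‖, ‖y‖ ≤ 1` — "`P` is NOT in the formal group".
[cite: SilvermanAEC2009, VII.3.1 and Exercise 3.7(d)] -/
theorem norm_le_one_of_prime_nsmul_eq_zero_of_addv (hadd : Addv W p) {x y : ℚ_[p]}
    (h : (W.baseChange ℚ_[p]).toAffine.Nonsingular x y) (h0 : p • (Affine.Point.some x y h) = 0) :
    ‖x‖ ≤ 1 ∧ ‖y‖ ≤ 1 :=
  norm_le_one_of_zsmul_eq_zero_of_addv W p hadd (n := p) (by exact_mod_cast hp.out.ne_zero) h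
    (by rw [natCast_zsmul]; exact h0)

end Integral

/-! ## §5 On the binders of LOW: the `ℚ_p`-rational `p`-torsion line of the Kosters–Pannekoek cell -/

section Low

open Literature.NumberTheory.EllipticCurves.Rank1Residual

/-- **The torsion line of the Kosters–Pannekoek cell.** For `W/ℚ` globally minimal, ADDITIVE at an odd prime `p`,
carrying a `ℚ_p`-rational point of order `p` (the binders of LOW `SupersingularTorsionOptimalManinUnitFive` at
`p = 5`, Kodaira II; also of CORNER / WILD / TAME at `(5, III)`, `(7, II)`): (i) `#E(ℚ_p)[p] = p`; (ii) `E(ℚ_p)[p]` is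
the line `⟨P⟩` of one point `P ≠ O`; (iii) every `ℚ_p`-rational `p`-torsion point has `p`-adically integral
coordinates on the minimal model (it is not in the formal group `E₁(ℚ_p)`; by Mazur's Step 1 — tree
`padicValRat_c₄_or_c₆_of_prime_zsmul_eq_zero_of_addv` — this happens only at `(p, v_p(c₄)) = (5, 1)` or
`(p, v_p(c₆)) = (7, 1)`). (i), (ii) are the sibling seat's `LocalPTorsion.natCard_torsionBy_padic_eq_of_ne_zero` /
`exists_generator_pTorsion_padic`; (iii) is §4. LINE-7's typable layer for stmt-BirchSwinnertonDyer-23884; the crux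
itself (`5 ∤ c(D)`) is not touched. [cite: SilvermanAEC2009, Cor. III.8.1.1 and VII.3.1] [cite: KostersPannekoek2017, Thm. 1 and Cor. 2] -/
theorem low_torsion_line (W : WeierstrassCurve ℚ) [W.IsElliptic] [W.IsGloballyMinimal] (p : ℕ) [Fact p.Prime]
    (hp2 : p ≠ 2) (hadd : Addv W p) (hex : ∃ P : (W.baseChange ℚ_[p]).toAffine.Point, p • P = 0 ∧ P ≠ 0) :
    Nat.card (AddSubgroup.torsionBy (W.baseChange ℚ_[p]).toAffine.Point (p : ℤ)) = p ∧
    (∃ P : (W.baseChange ℚ_[p]).toAffine.Point, p • P = 0 ∧ P ≠ 0 ∧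
      ∀ Q : (W.baseChange ℚ_[p]).toAffine.Point, p • Q = 0 → ∃ k : ℕ, Q = k • P) ∧
    (∀ {x y : ℚ_[p]} (h : (W.baseChange ℚ_[p]).toAffine.Nonsingular x y),
      p • (Affine.Point.some x y h) = 0 → ‖x‖ ≤ 1 ∧ ‖y‖ ≤ 1) := by
  obtain ⟨P, hP, hP0⟩ := hex
  exact ⟨TeichmullerTwistDescent.LocalPTorsion.natCard_torsionBy_padic_eq_of_ne_zero W p hp2 hP hP0,
    TeichmullerTwistDescent.LocalPTorsion.exists_generator_pTorsion_padic W p hp2 ⟨P, hP, hP0⟩,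
    fun h h0 => norm_le_one_of_prime_nsmul_eq_zero_of_addv W p hadd h h0⟩

end Low

end Summit.BirchSwinnertonDyer.BirchSwinnertonDyer.Theorems.TeichmullerTwistDescent.LocalPTorsionLine

end
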